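import Literature.Analysis.UnboundedOperators.HeatKernelGradient
import Literature.Analysis.UnboundedOperators.HeatKernelLpSmoothingProofs
import HarnessLib

/-!
# `L^p → L^q` smoothing of the gradient of the caloric extension

Analysis/UnboundedOperators support file (all proved). For the caloric extension
`e^{tΔ} f = heatExtension f t` on a finite-dimensional real inner product space `E`
(`n = dim E`), `1 ≤ p ≤ q ≤ ∞` and `0 < t`,

  `‖∇ e^{tΔ} f‖_{L^q} ≤ C t^{-1/2 - (n/2)(1/p - 1/q)} ‖f‖_{L^p}`

(`eLpNorm_fderiv_heatExtension_le_rpow`), obtained by writing `e^{tΔ} = e^{(t/2)Δ} e^{(t/2)Δ}`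
(accepted semigroup law `Literature.Analysis.UnboundedOperators.heatExtension_add`, discharged in the tree) and composing the tree's
two discharged estimates `‖∇ e^{sΔ} g‖_q ≤ C s^{-1/2} ‖g‖_q`
(`Literature.Analysis.UnboundedOperators.eLpNorm_fderiv_heatExtension_le`) and `‖e^{sΔ} f‖_q ≤ C s^{-(n/2)(1/p - 1/q)} ‖f‖_p`
(`Literature.Analysis.UnboundedOperators.eLpNorm_heatExtension_le_rpow`). This is Giga–Giga–Saal, *Nonlinear PDEs*, §1.1.3
(the `L^p`–`L^q` estimates for derivatives of `e^{tΔ}`, there in one stroke from the kernel);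
it serves the local-uniqueness step of `Literature.Analysis.FluidPDE.kato_unique` in the instance
`(n, p, q) = (3, 2, 3)`: `‖∇ e^{νσΔ} φ‖₃ ≤ C (νσ)^{-3/4} ‖φ‖₂`, which makes
`∫₀ᵗ ‖∇ e^{ν(t-τ)Δ} φ‖₃ dτ < ∞` and yields the a priori `L²` bound on the difference of two mild
solutions.

## References

* M.-H. Giga, Y. Giga, J. Saal, *Nonlinear Partial Differential Equations*, Birkhäuser 2010,
  §1.1.3 (the `L^p`–`L^q` estimates). Bib key `GigaGigaSaal2010`.
* P. G. Lemarié-Rieusset, *The Navier–Stokes problem in the 21st century* (2016), proof of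
  Thm. 7.7, p. 150 (`‖∇ W_{νt} * ·‖` bounds in the uniqueness argument).
-/

noncomputable section

open MeasureTheory Filter Topology
open scoped Real ENNReal NNReal

namespace Literature.Analysis.UnboundedOperators

variable {E : Type*} [NormedAddCommGroup E] [InnerProductSpace ℝ E] [FiniteDimensional ℝ E]
  [MeasurableSpace E] [BorelSpace E]
variable {F : Type*} [NormedAddCommGroup F] [NormedSpace ℝ F] [CompleteSpace F]

/-- **`L^p → L^q` smoothing of the gradient of the caloric extension**: for `1 ≤ p ≤ q ≤ ∞` there
is `C = C(E, F, p, q)` with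
`‖∇ e^{tΔ} f‖_{L^q} ≤ C t^{-1/2 - (n/2)(1/p - 1/q)} ‖f‖_{L^p}` for all `f ∈ L^p` and `0 < t`
(`n = dim E`, `1/∞ = 0` via `ENNReal.toReal`). Proof: `e^{tΔ}f = e^{(t/2)Δ}(e^{(t/2)Δ}f)`
and the tree's `‖∇e^{sΔ}g‖_q ≤ C₁ s^{-1/2}‖g‖_q`, `‖e^{sΔ}f‖_q ≤ C₂ s^{-(n/2)(1/p-1/q)}‖f‖_p`
with `s = t/2`. Giga–Giga–Saal 2010, §1.1.3. [cite: GigaGigaSaal2010, §1.1.3] -/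
theorem eLpNorm_fderiv_heatExtension_le_rpow {p q : ℝ≥0∞} (hp : 1 ≤ p) (hpq : p ≤ q) :
    ∃ C : ℝ≥0, ∀ (f : E → F), MemLp f p volume → ∀ t : ℝ, 0 < t →
      eLpNorm (fderiv ℝ (heatExtension f t)) q volume ≤
        C * ENNReal.ofReal (t ^ (-(1 / 2 : ℝ) -
          ((Module.finrank ℝ E : ℝ) / 2) * ((1 / p).toReal - (1 / q).toReal))) *
          eLpNorm f p volume := by
  have hq : 1 ≤ q := hp.trans hpq
  obtain ⟨C₁, hC₁⟩ := eLpNorm_fderiv_heatExtension_le_holds (E := E) (F := F) hq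
  obtain ⟨C₂, hC₂⟩ := eLpNorm_heatExtension_le_rpow_holds (E := E) (F := F) hp hpq
  set n : ℝ := (Module.finrank ℝ E : ℝ) with hn
  set a : ℝ := (n / 2) * ((1 / p).toReal - (1 / q).toReal) with ha
  have ha0 : 0 ≤ a := by
    have h1 : (1 / q).toReal ≤ (1 / p).toReal := by
      refine ENNReal.toReal_mono ?_ (by gcongr)
      simp only [one_div, ne_eq, ENNReal.inv_eq_top]
      exact (zero_lt_one.trans_le hp).ne'
    have : 0 ≤ (1 / p).toReal - (1 / q).toReal := sub_nonneg.2 h1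
    positivity
  -- the constant: `C₁ C₂ 2^{1/2 + a}`
  refine ⟨C₁ * C₂ * NNReal.mk ((2 : ℝ) ^ (1 / 2 + a)) (by positivity), fun f hf t ht => ?_⟩
  have hs : 0 < t / 2 := half_pos ht
  -- `g = e^{(t/2)Δ} f ∈ L^q`
  set g : E → F := heatExtension f (t / 2) with hg
  have hgm : AEStronglyMeasurable g volume :=
    (memLp_heatExtension_holds hf hp hs).aestronglyMeasurable
  have hgq : MemLp g q volume := by
    refine ⟨hgm, ?_⟩
    refine lt_of_le_of_lt (hC₂ f hf (t / 2) hs) ?_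
    refine ENNReal.mul_lt_top (ENNReal.mul_lt_top ENNReal.coe_lt_top ENNReal.ofReal_lt_top) hf.2
  -- semigroup law
  have hsemi : heatExtension f t = heatExtension g (t / 2) := by
    rw [hg, heatExtension_add_holds hf hp hs hs, add_halves]
  rw [hsemi]
  calc eLpNorm (fderiv ℝ (heatExtension g (t / 2))) q volume
      ≤ C₁ * ENNReal.ofReal ((t / 2) ^ (-(1 / 2 : ℝ))) * eLpNorm g q volume := hC₁ g hgq _ hs
    _ ≤ C₁ * ENNReal.ofReal ((t / 2) ^ (-(1 / 2 : ℝ))) *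
          (C₂ * ENNReal.ofReal ((t / 2) ^ (-a)) * eLpNorm f p volume) := by
        gcongr
        have h := hC₂ f hf (t / 2) hs
        simpa [ha, hn, neg_mul] using h
    _ = (C₁ * C₂ * NNReal.mk ((2 : ℝ) ^ (1 / 2 + a)) (by positivity) : ℝ≥0) *
          ENNReal.ofReal (t ^ (-(1 / 2 : ℝ) - a)) * eLpNorm f p volume := by
        -- real arithmetic of the powers
        have hpow : (t / 2) ^ (-(1 / 2 : ℝ)) * (t / 2) ^ (-a) =
            (2 : ℝ) ^ (1 / 2 + a) * t ^ (-(1 / 2 : ℝ) - a) := by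
          rw [← Real.rpow_add hs, show (-(1 / 2 : ℝ) + -a) = -(1 / 2 + a) by ring,
            Real.div_rpow ht.le zero_le_two, Real.rpow_neg zero_le_two,
            show (-(1 / 2 : ℝ) - a) = -(1 / 2 + a) by ring]
          have h2 : (2 : ℝ) ^ (1 / 2 + a) ≠ 0 := by positivity
          field_simp
        have hX : 0 ≤ (t / 2) ^ (-(1 / 2 : ℝ)) := Real.rpow_nonneg hs.le _
        have hprod : ENNReal.ofReal ((t / 2) ^ (-(1 / 2 : ℝ))) * ENNReal.ofReal ((t / 2) ^ (-a)) =
            ENNReal.ofReal ((2 : ℝ) ^ (1 / 2 + a)) * ENNReal.ofReal (t ^ (-(1 / 2 : ℝ) - a)) := by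
          rw [← ENNReal.ofReal_mul hX, hpow, ENNReal.ofReal_mul (by positivity)]
        have hcoe : ((NNReal.mk ((2 : ℝ) ^ (1 / 2 + a)) (by positivity) : ℝ≥0) : ℝ≥0∞) =
            ENNReal.ofReal ((2 : ℝ) ^ (1 / 2 + a)) :=
          (ENNReal.ofReal_eq_coe_nnreal _).symm
        rw [ENNReal.coe_mul, ENNReal.coe_mul, hcoe]
        calc (C₁ : ℝ≥0∞) * ENNReal.ofReal ((t / 2) ^ (-(1 / 2 : ℝ))) *
              ((C₂ : ℝ≥0∞) * ENNReal.ofReal ((t / 2) ^ (-a)) * eLpNorm f p volume)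
            = (C₁ : ℝ≥0∞) * C₂ * (ENNReal.ofReal ((t / 2) ^ (-(1 / 2 : ℝ))) *
                ENNReal.ofReal ((t / 2) ^ (-a))) * eLpNorm f p volume := by ring
          _ = _ := by rw [hprod]; ring

end Literature.Analysis.UnboundedOperators
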